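import Summits.QuantumFields.BalabanUV.Beta.ChartConjugationRemainderEnd
import Summits.QuantumFields.BalabanUV.Beta.SpineRecursiveClosed

/-!
# `hR` FOR THE RECURSIVELY TYPED WALL FAMILY WITH A TADPOLE-NULL REMAINDER SLOT IN (Wr-conj) — the wiring of
# `ChartConjugationRemainderEnd` through the centred block-mean dressing and the recursive spine; S-side CLOSED as before
# (β sub-cell, row BETA-an2 = BINDER-OWNERS row D1 OWNER, lineage an2 gen 17; decision (L4-R), leaf (W-END-REM) wiring part)

HONEST FRAMING (cell charter, verbatim): «discharging BetaPertH makes Balaban's UV stability UNCONDITIONAL — a real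
constructive-QFT result; it is NOT the continuum limit and NOT the Clay problem.»  DERIVED cell leaf: no statement of Bałaban's papers is
typed here, no `[cite:]` tag, no `def`, no `Prop` fact; it instantiates no binder of the β-function wall by itself.  NOT D1, NOT `BetaPertH`,
NOT continuum, NOT Clay.

## What is here ([folklore] wiring; every proof = the gen-16 proof with the remainder letters threaded through)

The four roots of `SpineRecursive` / `SpineRecursiveInductive` / `SpineRecursiveClosed` RE-ISSUED with the second-order socket (hWrC) replaced by
(hWrC-rem): `W j μ (bref y) ν (bref y′) = (ε_μ ε_ν) • refK (W j μ y ν y′ + conjW 𝕄_j V V′ C C′ (X₂ …) + Rm j α μ y ν y′)` together with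
(hRmL) `Loc (Rm j α μ y ν y′)` and (hRm0) `tadpole G_j (Rm j α μ y ν y′) = 0`, `G_j = coDressKBmAt ρ_c Lc (KInvStep Lc j)`:
* `axisReflectionCovariant_flipK_TbalOf_dressBmCtr_rel_rem` (the centred block-mean-dressed family over the relative sockets; twin of
  `AxialDressingRooted.axisReflectionCovariant_flipK_TbalOf_dressBmCtr_rel`);
* `axisReflectionCovariant_flipK_TbalOf_JsRecBmAtOf_ctrC_rem` (base wiring over `axEc`; twin of `SpineRecursive` §3);
* `axisReflectionCovariant_flipK_TbalOf_JsRecBmAtOf_ctrC_inductive_rem` (S-side by induction from `hn`, `hCT`, locks; twin of `SpineRecursiveInductive`);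
* **`axisReflectionCovariant_flipK_TbalOf_JsRecBmAtOf_ctrC_closed_rem`** and **`…_closed_bcj_rem`** (S-side CLOSED by `contactLaw_SrecAt`; at the pin
  `(cE, cVH) = (Lc⁴, −Lc⁸/2)`: **hR(v2.26) ⟸ EXACTLY the W-data + (hWt) + (hWrC-rem) + (hRmL) + (hRm0)**).
With `Rm := 0` these are the gen-16 roots.  WHY: `SecondOrderContactAssembly.W2OfK_sharp_split` shows the second-order contact of the (L4-D) literal is
`conjW … + Δ` with `Δ` tadpole-null by first-order parity/symmetry (leaf (W-TAD)) but not a `[𝕄, ·]`-contact; the END consumes only the tadpole.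
Provenance: β sub-cell, unit beta-an2 gen 17, 2026-08-20 (v1); over `ChartConjugationRemainderEnd` (an2 gen 17) and the gen-16 chain BY NAME; no existing file touched.
-/

open Finset
open scoped BigOperators
open Literature.MathematicalPhysics.QuantumFieldTheory
open Literature.MathematicalPhysics.QuantumFieldTheory.Balaban1983to89
open Literature.MathematicalPhysics.QuantumFieldTheory.Balaban1983to89.Beta
open ExpKernelCalculus (MKer Decays BiLoc comp tadpole VertexFamily VertexFamily₂ shiftK)
open AffineAveraging (box toSite)
open AveragingContoursRooted (ctr ctrOff ctrOff_mem_box)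
open PolarizationSign (reflSign AxisReflectionCovariant)
open KernelReflection (refK)
open ResolventReflection (bref Φ)
open OneStepResolventKernel (Fib LocStencil JetData)
open OneStepKernelFamily (KInvStep vertexOfK TbalOf flipK)
open BalabanStepJetsSucc (mmRead wE wVH)
open Summit.QuantumFields.BalabanUV.Beta.TameKernelCalculus
open Summit.QuantumFields.BalabanUV.Beta.ChartConjugation (conjV conjW)
open Summit.QuantumFields.BalabanUV.Beta.ChartConjugationRelative (RelInv)
open Summit.QuantumFields.BalabanUV.Beta.ChartConjugationRemainderEnd (axisReflectionCovariant_flipK_hessKer_conj_rem_rel)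
open Summit.QuantumFields.BalabanUV.Beta.AxialDressingRooted (dressBmAt coDressKBmAt axEc spr_axEc axEc_rules_coDressKBmAt_KInvStep
  one_le_of_neZero TbalOf_dressBmAt decays_coDressKBmAt_KInvStep shiftK_coDressKBmAt_KInvStep refK_coDressKBmAt_KInvStep)
open Summit.QuantumFields.BalabanUV.Beta.BorderedHessian (bhKAt diagK ctGen cCT comp_axEc_diagK_comm locStencil_smul_diagK_ctGen bhKStepAt
  stepScale spr_bhKStepAt relInv_coDressKBmAt_KInvStep_bhKStepAt)
open Summit.QuantumFields.BalabanUV.Beta.WardLocusRecursive (SrecAt)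

noncomputable section

namespace Summit.QuantumFields.BalabanUV.Beta.SpineRooted

/-! ## §1 The centred block-mean-dressed family over the relative sockets, with the remainder slot -/

section Dressed

/-- [folklore] **THE `hR` BINDER FOR THE CENTRED BLOCK-MEAN-DRESSED FAMILY OVER THE RELATIVE SOCKETS, WITH A TADPOLE-NULL REMAINDER** (twin of
`AxialDressingRooted.axisReflectionCovariant_flipK_TbalOf_dressBmCtr_rel`; `hGr` discharged by `refK_coDressKBmAt_KInvStep`, odd `Lc`). -/
theorem axisReflectionCovariant_flipK_TbalOf_dressBmCtr_rel_rem {Lc : ℕ} [NeZero Lc] (hLc : Odd Lc) (Js : ℕ → JetData 3 Lc)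
    (M : ℕ → MKer 4 (Fib 3)) (E : MKer 4 (Fib 3)) (hM : ∀ j, Spr (M j)) (hE : Spr E)
    (hR : ∀ j, RelInv (coDressKBmAt (toSite (ctrOff 4 Lc)) Lc (KInvStep (d := 3) Lc j)) (M j) E)
    (hSt : ∀ (j : ℕ) (κ' : Fin 4) (u t : Fin 4 → ℤ), (Js j).S κ' (u + (Lc : ℤ) • t) = ExpKernelCalculus.shiftK (-((Lc : ℤ) • t)) ((Js j).S κ' u))
    (hWt : ∀ (j : ℕ) (μ : Fin 4) (y : Fin 4 → ℤ) (ν : Fin 4) (y' t : Fin 4 → ℤ),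
      (Js j).W μ (y + t) ν (y' + t) = ExpKernelCalculus.shiftK (-((Lc : ℤ) • t)) ((Js j).W μ y ν y'))
    (C : ℕ → Fin 4 → Fin 4 → (Fin 4 → ℤ) → MKer 4 (Fib 3)) (Cc δc : ℕ → ℝ) (hC : ∀ j α, LocStencil (C j α) (Cc j) (δc j))
    (hδc : ∀ j, 0 < δc j) (X₂ Rm : ℕ → Fin 4 → Fin 4 → (Fin 4 → ℤ) → Fin 4 → (Fin 4 → ℤ) → MKer 4 (Fib 3))
    (hX₂ : ∀ j α μ y ν y', Loc (X₂ j α μ y ν y'))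
    (hEC : ∀ j α κ' u, comp E (C j α κ' u) = comp (C j α κ' u) E)
    (hEX₂ : ∀ j α μ y ν y', comp E (X₂ j α μ y ν y') = comp (X₂ j α μ y ν y') E)
    (hRmL : ∀ j α μ y ν y', Loc (Rm j α μ y ν y'))
    (hRm0 : ∀ j α μ y ν y', tadpole (coDressKBmAt (toSite (ctrOff 4 Lc)) Lc (KInvStep (d := 3) Lc j)) (Rm j α μ y ν y') = 0)
    (hSrC : ∀ (j : ℕ) (α κ' : Fin 4) (u : Fin 4 → ℤ),
      (Js j).S κ' (bref α κ' u) = reflSign α κ' • refK (Φ Lc α) ((Js j).S κ' u + conjV (M j) (C j α κ' u)))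
    (hWrC : ∀ (j : ℕ) (α μ : Fin 4) (y : Fin 4 → ℤ) (ν : Fin 4) (y' : Fin 4 → ℤ),
      (Js j).W μ (bref α μ y) ν (bref α ν y') = (reflSign α μ * reflSign α ν) • refK (Φ Lc α) ((Js j).W μ y ν y' +
        conjW (M j) (vertexOfK (coDressKBmAt (toSite (ctrOff 4 Lc)) Lc (KInvStep (d := 3) Lc j)) Lc (Js j).S μ y)
          (vertexOfK (coDressKBmAt (toSite (ctrOff 4 Lc)) Lc (KInvStep (d := 3) Lc j)) Lc (Js j).S ν y')
          (vertexOfK (coDressKBmAt (toSite (ctrOff 4 Lc)) Lc (KInvStep (d := 3) Lc j)) Lc (C j α) μ y)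
          (vertexOfK (coDressKBmAt (toSite (ctrOff 4 Lc)) Lc (KInvStep (d := 3) Lc j)) Lc (C j α) ν y') (X₂ j α μ y ν y') +
        Rm j α μ y ν y')) :
    ∀ j : ℕ, AxisReflectionCovariant
      (flipK (TbalOf Lc (fun j => dressBmAt (ctrOff_mem_box (d := 4) (one_le_of_neZero Lc)) (Js j)) j)) := by
  intro j
  rw [TbalOf_dressBmAt (ctrOff_mem_box (d := 4) (one_le_of_neZero Lc)) Js j]
  exact axisReflectionCovariant_flipK_hessKer_conj_rem_rel (decays_coDressKBmAt_KInvStep (ctrOff_mem_box (d := 4) (one_le_of_neZero Lc)) j)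
    (shiftK_coDressKBmAt_KInvStep (toSite (ctrOff 4 Lc)) j) (fun α => refK_coDressKBmAt_KInvStep (d := 3) hLc j α) (hM j) hE (hR j) (Js j)
    (hSt j) (hWt j) (C j) (hC j) (hδc j) (X₂ j) (Rm j) (hX₂ j) (hEC j) (hEX₂ j) (hRmL j) (hRm0 j) (hSrC j) (hWrC j)

end Dressed

/-! ## §2 The recursive family: base wiring over `axEc`, with the remainder slot -/

section Wiring

/-- [folklore] **`hR` FOR THE CENTRED Π_bm-CO-DRESSED RECURSIVE FAMILY OVER `axEc`, WITH A TADPOLE-NULL REMAINDER** (twin of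
`axisReflectionCovariant_flipK_TbalOf_JsRecBmAtOf_ctrC`; rules 1–2 inside by `axEc_rules_coDressKBmAt_KInvStep`). -/
theorem axisReflectionCovariant_flipK_TbalOf_JsRecBmAtOf_ctrC_rem {Lc : ℕ} [NeZero Lc] (hLc : Odd Lc) (cE cVH cΛ : ℝ)
    (W : ℕ → Fin 4 → (Fin 4 → ℤ) → Fin 4 → (Fin 4 → ℤ) → MKer 4 (Fib 3)) (Cw δw : ℕ → ℝ) (hδw : ∀ j, 0 < δw j)
    (hW : ∀ j, VertexFamily₂ (W j) Lc (Cw j) (δw j))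
    (hWt : ∀ (j : ℕ) (μ : Fin 4) (y : Fin 4 → ℤ) (ν : Fin 4) (y' t : Fin 4 → ℤ),
      W j μ (y + t) ν (y' + t) = shiftK (-((Lc : ℤ) • t)) (W j μ y ν y'))
    (M : ℕ → MKer 4 (Fib 3)) (hM : ∀ j, Spr (M j))
    (h3 : ∀ j, comp (comp (coDressKBmAt (toSite (ctrOff 4 Lc)) Lc (KInvStep (d := 3) Lc j)) (M j)) (axEc (toSite (ctrOff 4 Lc)) Lc) =
      axEc (toSite (ctrOff 4 Lc)) Lc)
    (h4 : ∀ j, comp (comp (axEc (toSite (ctrOff 4 Lc)) Lc) (M j)) (coDressKBmAt (toSite (ctrOff 4 Lc)) Lc (KInvStep (d := 3) Lc j)) =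
      axEc (toSite (ctrOff 4 Lc)) Lc)
    (C : ℕ → Fin 4 → Fin 4 → (Fin 4 → ℤ) → MKer 4 (Fib 3)) (Cc δc : ℕ → ℝ) (hC : ∀ j α, LocStencil (C j α) (Cc j) (δc j))
    (hδc : ∀ j, 0 < δc j) (X₂ Rm : ℕ → Fin 4 → Fin 4 → (Fin 4 → ℤ) → Fin 4 → (Fin 4 → ℤ) → MKer 4 (Fib 3))
    (hX₂ : ∀ j α μ y ν y', Loc (X₂ j α μ y ν y'))
    (hEC : ∀ j α κ' u, comp (axEc (toSite (ctrOff 4 Lc)) Lc) (C j α κ' u) = comp (C j α κ' u) (axEc (toSite (ctrOff 4 Lc)) Lc))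
    (hEX₂ : ∀ j α μ y ν y', comp (axEc (toSite (ctrOff 4 Lc)) Lc) (X₂ j α μ y ν y') = comp (X₂ j α μ y ν y') (axEc (toSite (ctrOff 4 Lc)) Lc))
    (hRmL : ∀ j α μ y ν y', Loc (Rm j α μ y ν y'))
    (hRm0 : ∀ j α μ y ν y', tadpole (coDressKBmAt (toSite (ctrOff 4 Lc)) Lc (KInvStep (d := 3) Lc j)) (Rm j α μ y ν y') = 0)
    (hSrC : ∀ (j : ℕ) (α κ' : Fin 4) (u : Fin 4 → ℤ),
      (JsRec0AtOf (d := 3) hLc.pos (ctrOff_mem_box hLc.pos) cE cVH cΛ W Cw δw hδw hW j).S κ' (bref α κ' u) =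
        reflSign α κ' • refK (Φ Lc α)
          ((JsRec0AtOf (d := 3) hLc.pos (ctrOff_mem_box hLc.pos) cE cVH cΛ W Cw δw hδw hW j).S κ' u + conjV (M j) (C j α κ' u)))
    (hWrC : ∀ (j : ℕ) (α μ : Fin 4) (y : Fin 4 → ℤ) (ν : Fin 4) (y' : Fin 4 → ℤ),
      (JsRec0AtOf (d := 3) hLc.pos (ctrOff_mem_box hLc.pos) cE cVH cΛ W Cw δw hδw hW j).W μ (bref α μ y) ν (bref α ν y') =
        (reflSign α μ * reflSign α ν) • refK (Φ Lc α)
          ((JsRec0AtOf (d := 3) hLc.pos (ctrOff_mem_box hLc.pos) cE cVH cΛ W Cw δw hδw hW j).W μ y ν y' +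
            conjW (M j)
              (vertexOfK (coDressKBmAt (toSite (ctrOff 4 Lc)) Lc (KInvStep (d := 3) Lc j)) Lc
                (JsRec0AtOf (d := 3) hLc.pos (ctrOff_mem_box hLc.pos) cE cVH cΛ W Cw δw hδw hW j).S μ y)
              (vertexOfK (coDressKBmAt (toSite (ctrOff 4 Lc)) Lc (KInvStep (d := 3) Lc j)) Lc
                (JsRec0AtOf (d := 3) hLc.pos (ctrOff_mem_box hLc.pos) cE cVH cΛ W Cw δw hδw hW j).S ν y')
              (vertexOfK (coDressKBmAt (toSite (ctrOff 4 Lc)) Lc (KInvStep (d := 3) Lc j)) Lc (C j α) μ y)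
              (vertexOfK (coDressKBmAt (toSite (ctrOff 4 Lc)) Lc (KInvStep (d := 3) Lc j)) Lc (C j α) ν y') (X₂ j α μ y ν y') +
            Rm j α μ y ν y')) :
    ∀ j : ℕ, AxisReflectionCovariant
      (flipK (TbalOf Lc (JsRecBmAtOf (d := 3) hLc.pos (ctrOff_mem_box hLc.pos) cE cVH cΛ W Cw δw hδw hW) j)) := by
  have hR : ∀ j, RelInv (coDressKBmAt (toSite (ctrOff 4 Lc)) Lc (KInvStep (d := 3) Lc j)) (M j) (axEc (toSite (ctrOff 4 Lc)) Lc) :=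
    fun j => ⟨(axEc_rules_coDressKBmAt_KInvStep (ctrOff_mem_box (one_le_of_neZero Lc)) j).1,
      (axEc_rules_coDressKBmAt_KInvStep (ctrOff_mem_box (one_le_of_neZero Lc)) j).2, h3 j, h4 j⟩
  exact axisReflectionCovariant_flipK_TbalOf_dressBmCtr_rel_rem hLc
    (JsRec0AtOf (d := 3) hLc.pos (ctrOff_mem_box hLc.pos) cE cVH cΛ W Cw δw hδw hW) M (axEc (toSite (ctrOff 4 Lc)) Lc) hM
    (spr_axEc _ _) hR (JsRec0AtOf_S_translate hLc.pos (ctrOff_mem_box hLc.pos) cE cVH cΛ W Cw δw hδw hW)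
    (JsRec0AtOf_W_translate hLc.pos (ctrOff_mem_box hLc.pos) cE cVH cΛ W Cw δw hδw hW hWt) C Cc δc hC hδc X₂ Rm hX₂ hEC hEX₂ hRmL hRm0 hSrC hWrC

end Wiring

/-! ## §3 The S-side by induction and CLOSED; the roots at the pin -/

section Root

/-- [folklore] **`hR` FOR THE RECURSIVE FAMILY, INDUCTIVE FORM, WITH A TADPOLE-NULL REMAINDER** (twin of `…_ctrC_inductive`: the S-side from `hn`, the
level-generic contact law `hCT` and the locks; the W-side sockets `X₂/hX₂/hEX₂`, (hWrC-rem), (hRmL), (hRm0)). -/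
theorem axisReflectionCovariant_flipK_TbalOf_JsRecBmAtOf_ctrC_inductive_rem {Lc : ℕ} [NeZero Lc] (hLc : Odd Lc) (cE cVH cΛ : ℝ)
    (hn : 2 * cVH = -(cE * (Lc : ℝ) ^ 4))
    (W : ℕ → Fin 4 → (Fin 4 → ℤ) → Fin 4 → (Fin 4 → ℤ) → MKer 4 (Fib 3)) (Cw δw : ℕ → ℝ) (hδw : ∀ j, 0 < δw j)
    (hW : ∀ j, VertexFamily₂ (W j) Lc (Cw j) (δw j))
    (hWt : ∀ (j : ℕ) (μ : Fin 4) (y : Fin 4 → ℤ) (ν : Fin 4) (y' t : Fin 4 → ℤ),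
      W j μ (y + t) ν (y' + t) = shiftK (-((Lc : ℤ) • t)) (W j μ y ν y'))
    (γ : ℕ → ℝ) (hγ : ∀ j, γ j = cVH * wVH 3 Lc j / (stepScale 3 Lc j * (Lc : ℝ) ^ 4))
    (hlock : ∀ j, cE * wE 3 Lc (j + 1) * (γ j / (stepScale 3 Lc j * (Lc : ℝ) ^ 4 * wVH 3 Lc (j + 1))) = γ (j + 1))
    (hCT : ∀ j : ℕ,
      (∀ (α κ : Fin 4) (u : Fin 4 → ℤ),
        SrecAt 3 Lc (toSite (ctrOff 4 Lc)) cE cVH cΛ j κ (bref α κ u) =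
          reflSign α κ • refK (Φ Lc α) (SrecAt 3 Lc (toSite (ctrOff 4 Lc)) cE cVH cΛ j κ u +
            conjV (bhKStepAt 3 (toSite (ctrOff 4 Lc)) Lc j) (γ j • diagK (ctGen 3 α Lc κ u)))) →
      ∀ (α κ' : Fin 4) (u' x z : Fin 4 → ℤ) (a b : Fin 4),
        e3OfK Lc (coDressKBmAt (toSite (ctrOff 4 Lc)) Lc (KInvStep (d := 3) Lc j)) (SrecAt 3 Lc (toSite (ctrOff 4 Lc)) cE cVH cΛ j) κ'
            (bref α κ' u') x z (Sum.inl a) (Sum.inl b) =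
          reflSign α κ' * ((Φ Lc α).s (Sum.inl a) * (Φ Lc α).s (Sum.inl b) *
            (e3OfK Lc (coDressKBmAt (toSite (ctrOff 4 Lc)) Lc (KInvStep (d := 3) Lc j)) (SrecAt 3 Lc (toSite (ctrOff 4 Lc)) cE cVH cΛ j) κ' u'
                ((Φ Lc α).r (Sum.inl a) x) ((Φ Lc α).r (Sum.inl b) z) (Sum.inl a) (Sum.inl b) +
              γ j / (stepScale 3 Lc j * (Lc : ℝ) ^ 4 * wVH 3 Lc (j + 1)) *
                conjV (bhKStepAt 3 (toSite (ctrOff 4 Lc)) Lc (j + 1)) (diagK (ctGen 3 α Lc κ' u'))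
                  ((Φ Lc α).r (Sum.inl a) x) ((Φ Lc α).r (Sum.inl b) z) (Sum.inl a) (Sum.inl b))))
    (X₂ Rm : ℕ → Fin 4 → Fin 4 → (Fin 4 → ℤ) → Fin 4 → (Fin 4 → ℤ) → MKer 4 (Fib 3)) (hX₂ : ∀ j α μ y ν y', Loc (X₂ j α μ y ν y'))
    (hEX₂ : ∀ j α μ y ν y', comp (axEc (toSite (ctrOff 4 Lc)) Lc) (X₂ j α μ y ν y') = comp (X₂ j α μ y ν y') (axEc (toSite (ctrOff 4 Lc)) Lc))
    (hRmL : ∀ j α μ y ν y', Loc (Rm j α μ y ν y'))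
    (hRm0 : ∀ j α μ y ν y', tadpole (coDressKBmAt (toSite (ctrOff 4 Lc)) Lc (KInvStep (d := 3) Lc j)) (Rm j α μ y ν y') = 0)
    (hWrC : ∀ (j : ℕ) (α μ : Fin 4) (y : Fin 4 → ℤ) (ν : Fin 4) (y' : Fin 4 → ℤ),
      (JsRec0AtOf (d := 3) hLc.pos (ctrOff_mem_box hLc.pos) cE cVH cΛ W Cw δw hδw hW j).W μ (bref α μ y) ν (bref α ν y') =
        (reflSign α μ * reflSign α ν) • refK (Φ Lc α)
          ((JsRec0AtOf (d := 3) hLc.pos (ctrOff_mem_box hLc.pos) cE cVH cΛ W Cw δw hδw hW j).W μ y ν y' +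
            conjW (bhKStepAt 3 (toSite (ctrOff 4 Lc)) Lc j)
              (vertexOfK (coDressKBmAt (toSite (ctrOff 4 Lc)) Lc (KInvStep (d := 3) Lc j)) Lc
                (JsRec0AtOf (d := 3) hLc.pos (ctrOff_mem_box hLc.pos) cE cVH cΛ W Cw δw hδw hW j).S μ y)
              (vertexOfK (coDressKBmAt (toSite (ctrOff 4 Lc)) Lc (KInvStep (d := 3) Lc j)) Lc
                (JsRec0AtOf (d := 3) hLc.pos (ctrOff_mem_box hLc.pos) cE cVH cΛ W Cw δw hδw hW j).S ν y')
              (vertexOfK (coDressKBmAt (toSite (ctrOff 4 Lc)) Lc (KInvStep (d := 3) Lc j)) Lc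
                (fun κ u => γ j • diagK (ctGen 3 α Lc κ u)) μ y)
              (vertexOfK (coDressKBmAt (toSite (ctrOff 4 Lc)) Lc (KInvStep (d := 3) Lc j)) Lc
                (fun κ u => γ j • diagK (ctGen 3 α Lc κ u)) ν y') (X₂ j α μ y ν y') +
            Rm j α μ y ν y')) :
    ∀ j : ℕ, AxisReflectionCovariant
      (flipK (TbalOf Lc (JsRecBmAtOf (d := 3) hLc.pos (ctrOff_mem_box hLc.pos) cE cVH cΛ W Cw δw hδw hW) j)) := by
  have hL1 : 1 ≤ Lc := one_le_of_neZero Lc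
  have hRel := relInv_coDressKBmAt_KInvStep_bhKStepAt (d := 3) (Lc := Lc) (ctrOff_mem_box hL1)
  have hC : ∀ j (α : Fin 4), LocStencil (fun κ u => γ j • diagK (ctGen 3 α Lc κ u)) (|γ j| * cCT 3 Lc 1) 1 :=
    fun j α => locStencil_smul_diagK_ctGen α Lc (γ j) zero_le_one
  have hEC : ∀ j (α κ : Fin 4) (u : Fin 4 → ℤ), comp (axEc (toSite (ctrOff 4 Lc)) Lc) ((fun κ u => γ j • diagK (ctGen 3 α Lc κ u)) κ u) =
      comp ((fun κ u => γ j • diagK (ctGen 3 α Lc κ u)) κ u) (axEc (toSite (ctrOff 4 Lc)) Lc) := by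
    intro j α κ u
    show comp (axEc (toSite (ctrOff 4 Lc)) Lc) (γ j • diagK (ctGen 3 α Lc κ u)) = comp (γ j • diagK (ctGen 3 α Lc κ u)) (axEc (toSite (ctrOff 4 Lc)) Lc)
    rw [KernelReflection.comp_smul_right, KernelReflection.comp_smul_left, comp_axEc_diagK_comm]
  have hSrC := hSrC_SrecAt_all_of_contactLaw hLc cE cVH cΛ hn γ hγ hlock hCT
  exact axisReflectionCovariant_flipK_TbalOf_JsRecBmAtOf_ctrC_rem hLc cE cVH cΛ W Cw δw hδw hW hWt (bhKStepAt 3 (toSite (ctrOff 4 Lc)) Lc)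
    (spr_bhKStepAt (ctrOff_mem_box hL1)) (fun j => (hRel j).AME) (fun j => (hRel j).EMA)
    (fun j α κ u => γ j • diagK (ctGen 3 α Lc κ u)) (fun j => |γ j| * cCT 3 Lc 1) (fun _ => 1) hC (fun _ => one_pos) X₂ Rm hX₂ hEC hEX₂ hRmL hRm0
    (fun j α κ u => by rw [JsRec0AtOf_S]; exact hSrC j α κ u) hWrC

/-- [folklore] **`hR` FOR THE RECURSIVE FAMILY, S-SIDE CLOSED, WITH A TADPOLE-NULL REMAINDER** (twin of `…_ctrC_closed`: `hCT := contactLaw_SrecAt`). -/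
theorem axisReflectionCovariant_flipK_TbalOf_JsRecBmAtOf_ctrC_closed_rem {Lc : ℕ} [NeZero Lc] (hLc : Odd Lc) (cE cVH cΛ : ℝ)
    (hn : 2 * cVH = -(cE * (Lc : ℝ) ^ 4))
    (W : ℕ → Fin 4 → (Fin 4 → ℤ) → Fin 4 → (Fin 4 → ℤ) → MKer 4 (Fib 3)) (Cw δw : ℕ → ℝ) (hδw : ∀ j, 0 < δw j)
    (hW : ∀ j, VertexFamily₂ (W j) Lc (Cw j) (δw j))
    (hWt : ∀ (j : ℕ) (μ : Fin 4) (y : Fin 4 → ℤ) (ν : Fin 4) (y' t : Fin 4 → ℤ),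
      W j μ (y + t) ν (y' + t) = shiftK (-((Lc : ℤ) • t)) (W j μ y ν y'))
    (γ : ℕ → ℝ) (hγ : ∀ j, γ j = cVH * wVH 3 Lc j / (stepScale 3 Lc j * (Lc : ℝ) ^ 4))
    (hlock : ∀ j, cE * wE 3 Lc (j + 1) * (γ j / (stepScale 3 Lc j * (Lc : ℝ) ^ 4 * wVH 3 Lc (j + 1))) = γ (j + 1))
    (X₂ Rm : ℕ → Fin 4 → Fin 4 → (Fin 4 → ℤ) → Fin 4 → (Fin 4 → ℤ) → MKer 4 (Fib 3)) (hX₂ : ∀ j α μ y ν y', Loc (X₂ j α μ y ν y'))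
    (hEX₂ : ∀ j α μ y ν y', comp (axEc (toSite (ctrOff 4 Lc)) Lc) (X₂ j α μ y ν y') = comp (X₂ j α μ y ν y') (axEc (toSite (ctrOff 4 Lc)) Lc))
    (hRmL : ∀ j α μ y ν y', Loc (Rm j α μ y ν y'))
    (hRm0 : ∀ j α μ y ν y', tadpole (coDressKBmAt (toSite (ctrOff 4 Lc)) Lc (KInvStep (d := 3) Lc j)) (Rm j α μ y ν y') = 0)
    (hWrC : ∀ (j : ℕ) (α μ : Fin 4) (y : Fin 4 → ℤ) (ν : Fin 4) (y' : Fin 4 → ℤ),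
      (JsRec0AtOf (d := 3) hLc.pos (ctrOff_mem_box hLc.pos) cE cVH cΛ W Cw δw hδw hW j).W μ (bref α μ y) ν (bref α ν y') =
        (reflSign α μ * reflSign α ν) • refK (Φ Lc α)
          ((JsRec0AtOf (d := 3) hLc.pos (ctrOff_mem_box hLc.pos) cE cVH cΛ W Cw δw hδw hW j).W μ y ν y' +
            conjW (bhKStepAt 3 (toSite (ctrOff 4 Lc)) Lc j)
              (vertexOfK (coDressKBmAt (toSite (ctrOff 4 Lc)) Lc (KInvStep (d := 3) Lc j)) Lc
                (JsRec0AtOf (d := 3) hLc.pos (ctrOff_mem_box hLc.pos) cE cVH cΛ W Cw δw hδw hW j).S μ y)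
              (vertexOfK (coDressKBmAt (toSite (ctrOff 4 Lc)) Lc (KInvStep (d := 3) Lc j)) Lc
                (JsRec0AtOf (d := 3) hLc.pos (ctrOff_mem_box hLc.pos) cE cVH cΛ W Cw δw hδw hW j).S ν y')
              (vertexOfK (coDressKBmAt (toSite (ctrOff 4 Lc)) Lc (KInvStep (d := 3) Lc j)) Lc
                (fun κ u => γ j • diagK (ctGen 3 α Lc κ u)) μ y)
              (vertexOfK (coDressKBmAt (toSite (ctrOff 4 Lc)) Lc (KInvStep (d := 3) Lc j)) Lc
                (fun κ u => γ j • diagK (ctGen 3 α Lc κ u)) ν y') (X₂ j α μ y ν y') +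
            Rm j α μ y ν y')) :
    ∀ j : ℕ, AxisReflectionCovariant
      (flipK (TbalOf Lc (JsRecBmAtOf (d := 3) hLc.pos (ctrOff_mem_box hLc.pos) cE cVH cΛ W Cw δw hδw hW) j)) :=
  axisReflectionCovariant_flipK_TbalOf_JsRecBmAtOf_ctrC_inductive_rem hLc cE cVH cΛ hn W Cw δw hδw hW hWt γ hγ hlock
    (fun j hP => contactLaw_SrecAt hLc cE cVH cΛ γ j hP) X₂ Rm hX₂ hEX₂ hRmL hRm0 hWrC

/-- [folklore] **`hR` AT THE PIN `(cE, cVH) = (Lc⁴, −Lc⁸/2)` WITH A TADPOLE-NULL REMAINDER ⟸ EXACTLY THE W-SIDE**: the W-data with (hWt), the conjugated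
second-order law WITH REMAINDER (hWrC-rem) — contacts `X₂` (localised, `axEc`-commuting) and remainders `Rm` (localised, zero tadpole against
`G_j`).  This is the consumer socket of the W-literal of row D1 after decision (L4-R). -/
theorem axisReflectionCovariant_flipK_TbalOf_JsRecBmAtOf_ctrC_closed_bcj_rem {Lc : ℕ} [NeZero Lc] (hLc : Odd Lc) (cΛ : ℝ)
    (W : ℕ → Fin 4 → (Fin 4 → ℤ) → Fin 4 → (Fin 4 → ℤ) → MKer 4 (Fib 3)) (Cw δw : ℕ → ℝ) (hδw : ∀ j, 0 < δw j)
    (hW : ∀ j, VertexFamily₂ (W j) Lc (Cw j) (δw j))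
    (hWt : ∀ (j : ℕ) (μ : Fin 4) (y : Fin 4 → ℤ) (ν : Fin 4) (y' t : Fin 4 → ℤ),
      W j μ (y + t) ν (y' + t) = shiftK (-((Lc : ℤ) • t)) (W j μ y ν y'))
    (γ : ℕ → ℝ) (hγ : ∀ j, γ j = -((Lc : ℝ) ^ 8 / 2) * wVH 3 Lc j / (stepScale 3 Lc j * (Lc : ℝ) ^ 4))
    (X₂ Rm : ℕ → Fin 4 → Fin 4 → (Fin 4 → ℤ) → Fin 4 → (Fin 4 → ℤ) → MKer 4 (Fib 3)) (hX₂ : ∀ j α μ y ν y', Loc (X₂ j α μ y ν y'))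
    (hEX₂ : ∀ j α μ y ν y', comp (axEc (toSite (ctrOff 4 Lc)) Lc) (X₂ j α μ y ν y') = comp (X₂ j α μ y ν y') (axEc (toSite (ctrOff 4 Lc)) Lc))
    (hRmL : ∀ j α μ y ν y', Loc (Rm j α μ y ν y'))
    (hRm0 : ∀ j α μ y ν y', tadpole (coDressKBmAt (toSite (ctrOff 4 Lc)) Lc (KInvStep (d := 3) Lc j)) (Rm j α μ y ν y') = 0)
    (hWrC : ∀ (j : ℕ) (α μ : Fin 4) (y : Fin 4 → ℤ) (ν : Fin 4) (y' : Fin 4 → ℤ),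
      (JsRec0AtOf (d := 3) hLc.pos (ctrOff_mem_box hLc.pos) ((Lc : ℝ) ^ 4) (-((Lc : ℝ) ^ 8 / 2)) cΛ W Cw δw hδw hW j).W μ (bref α μ y) ν
          (bref α ν y') =
        (reflSign α μ * reflSign α ν) • refK (Φ Lc α)
          ((JsRec0AtOf (d := 3) hLc.pos (ctrOff_mem_box hLc.pos) ((Lc : ℝ) ^ 4) (-((Lc : ℝ) ^ 8 / 2)) cΛ W Cw δw hδw hW j).W μ y ν y' +
            conjW (bhKStepAt 3 (toSite (ctrOff 4 Lc)) Lc j)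
              (vertexOfK (coDressKBmAt (toSite (ctrOff 4 Lc)) Lc (KInvStep (d := 3) Lc j)) Lc
                (JsRec0AtOf (d := 3) hLc.pos (ctrOff_mem_box hLc.pos) ((Lc : ℝ) ^ 4) (-((Lc : ℝ) ^ 8 / 2)) cΛ W Cw δw hδw hW j).S μ y)
              (vertexOfK (coDressKBmAt (toSite (ctrOff 4 Lc)) Lc (KInvStep (d := 3) Lc j)) Lc
                (JsRec0AtOf (d := 3) hLc.pos (ctrOff_mem_box hLc.pos) ((Lc : ℝ) ^ 4) (-((Lc : ℝ) ^ 8 / 2)) cΛ W Cw δw hδw hW j).S ν y')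
              (vertexOfK (coDressKBmAt (toSite (ctrOff 4 Lc)) Lc (KInvStep (d := 3) Lc j)) Lc
                (fun κ u => γ j • diagK (ctGen 3 α Lc κ u)) μ y)
              (vertexOfK (coDressKBmAt (toSite (ctrOff 4 Lc)) Lc (KInvStep (d := 3) Lc j)) Lc
                (fun κ u => γ j • diagK (ctGen 3 α Lc κ u)) ν y') (X₂ j α μ y ν y') +
            Rm j α μ y ν y')) :
    ∀ j : ℕ, AxisReflectionCovariant
      (flipK (TbalOf Lc (JsRecBmAtOf (d := 3) hLc.pos (ctrOff_mem_box hLc.pos) ((Lc : ℝ) ^ 4) (-((Lc : ℝ) ^ 8 / 2)) cΛ W Cw δw hδw hW) j)) := by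
  refine axisReflectionCovariant_flipK_TbalOf_JsRecBmAtOf_ctrC_closed_rem hLc ((Lc : ℝ) ^ 4) (-((Lc : ℝ) ^ 8 / 2)) cΛ (by ring) W Cw δw hδw
    hW hWt γ hγ (fun j => ?_) X₂ Rm hX₂ hEX₂ hRmL hRm0 hWrC
  rw [hγ, hγ]
  exact locks_of_pin (Lc := Lc) ((Lc : ℝ) ^ 4) (-((Lc : ℝ) ^ 8 / 2)) (pin_of_bcj (Lc := Lc) _ rfl) j

end Root

end Summit.QuantumFields.BalabanUV.Beta.SpineRooted

end
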